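import Summits.ABC.IUTFork.Repair.CandJoshi24
import Summits.ABC.IUTFork.Repair.EvalValUProfile
import HarnessLib

/-!
# IUT REPAIR BRANCH (LADDER-ABC:A2.RP), class (iii) JOSHI, j2 — «VAL(U)» II: THE SCHEMA over the scalar group `U`, first half —
# honest volumes for every `U`; S ⟺ `¼ ∈ U`; Step (x) log-volume invariance ⟺ `U = ⊥`; H_J21-5 ⟺ `U ≠ ⊥`

Record file of the abc-iut cell's IUT REPAIR BRANCH (seat abc-iut-rp-j2, gen 3; row RP-J05 door (a), price SCHEMA; sequel to
`Repair/CandJoshi24`). TAKES NO SIDE on [IUTchIII] Cor. 3.12 or on any author. PROOF-ONLY but for the packet-automorphism families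
`uHead` (no `Prop` def, no `Prop` fact); interface-level toy over `toyIndex` (`l⋇ = 2`); typed ≠ proved ≠ endorsed.
RESULTS, for every subgroup `U ≤ ℚˣ` (the value chart `uSetting p U` of `CandJoshi24`, reading `uRho`, honest q-datum `uQDatum`):
* §1 the (Ind2)-families `uHead c` («multiply the last tensor factor at label `j` by `c_j ∈ U`»; line scalar EXACTLY `c_j`);
* §2 HONEST VOLUMES for every `U`: q-volume `−log p` label-independently (rp-cx's `EvalValUProfile.valU_qLocal`), `u_hscaled` (exact `j²`), `|log(q)| > 0`, monotone volume,
  Step (x) ADMISSIBILITY-invariance `u_hAdm` (for `U` inside the positive rationals);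
* §3 **`u_residual_iff` : S = `PilotKummerIndRelated` ⟺ `¼ ∈ U`** (and H_J21-2 `JoshiScalingIndeterminacy` ⟺ `¼ ∈ U`, `u_H2_iff`): the
  residual is the membership in the indeterminacy group of ONE scalar — the inverse of Joshi's law `v_{K_2} = 2²·v_{K_1}`
  (arXiv:2303.01662 Thm. 6.9.1 (1) p. 17 l. 49–50, (3) l. 52–53; (9.2.3) p. 27);
* §4 **`u_logvolInvariant_iff` : Step (x) log-volume invariance (`MRData.LogvolInvariant`) ⟺ `U = ⊥`**; H_J21-5
  `JoshiNonIsometricIndeterminacy` ⟺ `U ≠ ⊥` (`u_H5_iff`).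
The hull side (possible images, `−|log(Θ)|`, the typed Statement ⟺ `U ≠ ⊥`, the packaged schema and the instances `⊥`, `⟨4⟩`, `⟨16⟩`)
is the sequel `CandJoshi24Hull`. HONEST SCOPE: the files price the READING «Θ_gau-scaling ∈ (Ind1)/(Ind2)» in Joshi's own
(valuation-multiplicative) typing; they do not read [IUTchIII], whose (Ind1)/(Ind2) are isometries (Step (x) p. 181 l. 5–13).
[claim: Mochizuki2012, status: disputed] [claim: Joshi2023ATS2Local, status: disputed] [claim: Joshi2021ATS1, status: disputed]
-/

noncomputable section

open Set

namespace Summit.ABC.IUTFork.Repair.CandJoshi24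

open Thm311 Cor312 Cor312.Checks Cor312.IdentifiedNonVacuity Cor312Vol Cor312Vol.NaiveWitness Cor312Vol.UnitWitness
  Cor312Vol.PinnedWitness Literature.IUT.LogThetaLattice Summit.ABC.IUTFork.Repair Summit.ABC.IUTFork.Repair.ScalarShells
  Summit.ABC.IUTFork.Repair.ScalarShellsThm311

variable (p : ℕ) (U : Subgroup ℚˣ)

/-! ## 1. Single-factor (Ind2)-families with prescribed scalars -/

/-- **`uHead c`** — the (Ind2)-family «at label `j`, multiply the last tensor factor by `c_j`» of the value-chart shells over `U`
(as `CandJoshi23.headFam`; line scalar EXACTLY `c_j`). [claim: Mochizuki2012, status: disputed] -/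
def uHead (c : toyIndex.Label → ℚˣ) : (uShells p U).PacketAut := fun j vQ =>
  (uShells p U).factorwise j vQ fun i =>
    (uShells p U).summandwise vQ fun _ => mulEquiv (CandJoshi23.lastScalar c j i : ℚ) (CandJoshi23.lastScalar c j i).ne_zero

variable {p U} in
/-- For `c_j ∈ U`, `uHead c` is an (Ind2)-family of the value-chart shells over `U`. [folklore] -/
theorem uHead_mem_Ind2Family {c : toyIndex.Label → ℚˣ} (hc : ∀ j, c j ∈ U) :
    uHead p U c ∈ (uShells p U).Ind2Family := fun j vQ =>
  ⟨fun i _ => mulEquiv (CandJoshi23.lastScalar c j i : ℚ) (CandJoshi23.lastScalar c j i).ne_zero,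
    fun i _ => mulEquiv_mem_scalarAuts U (by unfold CandJoshi23.lastScalar; split_ifs; exacts [hc j, U.one_mem]), rfl⟩

variable {p U} in
/-- … hence an element of `⟨(Ind1) ∪ (Ind2)⟩`. [folklore] -/
theorem uHead_mem_closure {c : toyIndex.Label → ℚˣ} (hc : ∀ j, c j ∈ U) :
    uHead p U c ∈ Subgroup.closure ((uShells p U).Ind1Family ∪ (uShells p U).Ind2Family) :=
  Subgroup.subset_closure (Or.inr (uHead_mem_Ind2Family hc))

/-- On the packet line at label `j`, `uHead c` is EXACTLY the scalar `c_j` (multilinearity). [folklore] -/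
theorem line_uHead (c : toyIndex.Label → ℚˣ) (j : toyIndex.Label) (vQ : toyIndex.VQ) (x : (uShells p U).Packet j vQ) :
    line j vQ (uHead p U c j vQ x) = (c j : ℚ) * line j vQ x := by
  have h := line_factorwise_of_smul j vQ
    (fun i => (uShells p U).summandwise vQ fun _ => mulEquiv (CandJoshi23.lastScalar c j i : ℚ) (CandJoshi23.lastScalar c j i).ne_zero)
    (fun i => (CandJoshi23.lastScalar c j i : ℚ)) (fun _ y => by funext v; rfl) x
  rw [CandJoshi23.prod_lastScalar] at h
  exact h

/-- The constant family `uHead (u, u, u)`, `u > 0`, carries `H_a` onto `H_{u·a}` at every packet. [folklore] -/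
theorem image_uHalf_uHead_const {u : ℚˣ} (hu0 : (0 : ℚ) < u) (j : toyIndex.Label) (vQ : toyIndex.VQ) (a : ℚ) :
    uHead p U (fun _ => u) j vQ '' uHalf p U j vQ a = uHalf p U j vQ ((u : ℚ) * a) :=
  image_uHalf_of_line_eq p U _ hu0 (line_uHead p U (fun _ => u) j vQ) a

/-- `μ(H_a) = μ(H_b) ⟹ a = b` (`log p ≠ 0`). [folklore] -/
theorem eq_of_uVol_uHalf_eq [hp : Fact p.Prime] {j : toyIndex.Label} {vQ : toyIndex.VQ} {a b : ℚ}
    (h : uVol p U j vQ (uHalf p U j vQ a) = uVol p U j vQ (uHalf p U j vQ b)) : a = b := by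
  rw [uVol_uHalf, uVol_uHalf] at h
  have h' := mul_right_cancel₀ (log_p_pos p).ne' h
  exact_mod_cast neg_inj.1 h'

/-! ## 2. Honest volumes, for every `U` -/

-- `u_qLocal` («qLocal = −log p», label-independent) is abc-iut-rp-cx's `EvalValUProfile.valU_qLocal` (landed first; reused).

/-- `−|log(q)| = −log p`. [folklore] -/
theorem u_negLogQ : (uSetting p U).negLogQ = -Real.log p := by
  unfold Setting.negLogQ
  have h : (fun i : Fin toyIndex.lstar => ∑ᶠ vQ : toyIndex.VQ, (uSetting p U).qLocal (Setting.labelSucc i) vQ) =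
      fun _ => -Real.log p := by
    funext i; rw [finsum_unique]; exact EvalValUProfile.valU_qLocal p U _ _
  rw [h]
  exact processionNormalized_const (by decide) _

/-- **HONEST `j²`-SCALING in every packet of `𝔽_l^⋇`**: `μ(ρ Ψ_n at label j) = μ(H_{j²}) = j²·qLocal`. [folklore] -/
theorem u_hscaled (i : Fin toyIndex.lstar) (vQ : toyIndex.VQ) :
    ((uFull p U).D (uSetting p U).n).logvol _ vQ (uRho p U ((uFull p U).D (uSetting p U).n).Ψ (Setting.labelSucc i) vQ) =
      (((i : ℕ) + 1 : ℕ) : ℝ) ^ 2 * (uSetting p U).qLocal (Setting.labelSucc i) vQ := by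
  have hΨ : ((uFull p U).D (uSetting p U).n).Ψ = fun v _ => uPsi p U v := rfl
  rw [hΨ, uRho_uPsi, EvalValUProfile.valU_qLocal]
  show uVol p U _ vQ (uHalf p U _ vQ (jsq (Setting.labelSucc i) : ℚ)) = _
  rw [uVol_uHalf]
  have hj : ((jsq (Setting.labelSucc i) : ℚ) : ℝ) = (((i : ℕ) + 1 : ℕ) : ℝ) ^ 2 := by
    unfold jsq
    rw [show ((Setting.labelSucc i : toyIndex.Label) : ℕ) = (i : ℕ) + 1 from Fin.val_succ i]
    push_cast; ring
  rw [hj]; ring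

/-- **`|log(q)| > 0`.** [folklore] -/
theorem u_absLogQPos [Fact p.Prime] : (uSetting p U).AbsLogQPos := by
  show (uSetting p U).negLogQ < 0
  rw [u_negLogQ, neg_lt_zero]
  exact log_p_pos p

/-- Monotone log-volume on admissible regions. [folklore] -/
theorem u_logvolMono [Fact p.Prime] : LogvolMono (uSetting p U) := by
  intro i vQ A B hA hB hAB
  obtain ⟨a, rfl⟩ := hA
  obtain ⟨b, rfl⟩ := hB
  show uVol p U _ vQ (uHalf p U _ vQ a) ≤ uVol p U _ vQ (uHalf p U _ vQ b)
  rw [uVol_uHalf, uVol_uHalf]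
  have hba : ((b : ℚ) : ℝ) ≤ ((a : ℚ) : ℝ) := by exact_mod_cast le_of_uHalf_subset p U hAB
  have := log_p_pos p
  nlinarith

/-- **Step (x) ADMISSIBILITY-invariance (w4-d103's `hAdm`) HOLDS for every `U` inside the positive rationals.** [folklore] -/
theorem u_hAdm (hU : U ≤ Units.posSubgroup ℚ) : ∀ Φ ∈ (uShells p U).Ind1Family ∪ (uShells p U).Ind2Family,
    ∀ (j : toyIndex.Label) (vQ : toyIndex.VQ) (B : Set ((uShells p U).Packet j vQ)),
      (uData p U).Adm j vQ B ↔ (uData p U).Adm j vQ (Φ j vQ '' B) := by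
  intro Φ hΦ j vQ B
  obtain ⟨u, hu, hΦc⟩ := (ScalarShells.actsByScalars_of_mem_closure (Subgroup.subset_closure hΦ)).scalar j vQ
  have hu0 : (0 : ℚ) < u := (Units.mem_posSubgroup _).1 (hU hu)
  constructor
  · rintro ⟨a, rfl⟩
    exact ⟨u * a, image_uHalf_of_line_eq p U (Φ j vQ) hu0 hΦc a⟩
  · rintro ⟨b, hb⟩
    have hsymm : ∀ y, line j vQ ((Φ j vQ).symm y) = (u : ℚ)⁻¹ * line j vQ y := fun y => by
      have h1 := hΦc ((Φ j vQ).symm y)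
      rw [LinearEquiv.apply_symm_apply] at h1
      rw [h1, ← mul_assoc, inv_mul_cancel₀ u.ne_zero, one_mul]
    have hB : B = (Φ j vQ).symm '' (Φ j vQ '' B) := by
      rw [Set.image_image]; simp
    refine ⟨(u : ℚ)⁻¹ * b, ?_⟩
    rw [hB, hb]
    exact image_uHalf_of_line_eq p U (Φ j vQ).symm (inv_pos.2 hu0) hsymm b

/-! ## 3. The residual is decided by ONE scalar: S ⟺ `¼ ∈ U` -/

/-- `(j²)` at the label `2 ∈ 𝔽_l^⋇` is `4`. [folklore] -/
theorem jsq_two : ((jsq (2 : toyIndex.Label) : ℤ) : ℚ) = 4 := by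
  unfold jsq; rw [CandJoshi23.label_two_val]; norm_num

/-- The label `2` lies in `𝔽_l^⋇`. [folklore] -/
theorem two_ne_zero_label : (2 : toyIndex.Label) ≠ 0 := by decide

variable {U} in
/-- If `¼ ∈ U`, the scalar vector `CandJoshi23.cJ = (1, 1, ¼)` (Joshi's law undone at label `2`) lies in `U`. [folklore] -/
theorem cJ_mem_of (hq : CandJoshi23.quarter ∈ U) (j : toyIndex.Label) : CandJoshi23.cJ j ∈ U := by
  unfold CandJoshi23.cJ; split_ifs; exacts [hq, U.one_mem]

/-- **`uHead CandJoshi23.cJ` carries the Θ-datum `(j²)_j` ONTO the q-datum `(1)_j`** (as `CandJoshi23.starAut_jMove_vPsi`). [folklore] -/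
theorem starAut_uHead_cJ (v : toyIndex.V) (hv : v ∈ toyIndex.Vbad) :
    (uShells p U).starAut (uHead p U CandJoshi23.cJ) v '' uPsi p U v = uQDatum p U v hv := by
  have key : ∀ (f : (uShells p U).StarPacket v) (j : toyIndex.LabelStar),
      line j.1 (toyIndex.over v) ((uShells p U).starAut (uHead p U CandJoshi23.cJ) v f j) = (CandJoshi23.cJ j.1 : ℚ) * line j.1 (toyIndex.over v) (f j) :=
    fun f j => line_uHead p U CandJoshi23.cJ j.1 (toyIndex.over v) (f j)
  apply Set.Subset.antisymm
  · rintro _ ⟨f, hf, rfl⟩ j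
    rw [key, hf j, CandJoshi23.cJ_mul_jsq]
  · intro g hg
    refine ⟨((uShells p U).starAut (uHead p U CandJoshi23.cJ) v).symm g, fun j => ?_, LinearEquiv.apply_symm_apply _ _⟩
    have h1 := key (((uShells p U).starAut (uHead p U CandJoshi23.cJ) v).symm g) j
    rw [LinearEquiv.apply_symm_apply, hg j] at h1
    apply mul_left_cancel₀ (CandJoshi23.cJ j.1).ne_zero
    rw [← h1, CandJoshi23.cJ_mul_jsq]

/-- **H_J21-2 `JoshiScalingIndeterminacy` in the value chart over `U` ⟺ `¼ ∈ U`** (any `U ≤ ℚˣ`): a move of `⟨(Ind1)∪(Ind2)⟩` carrying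
`Ψ_n` onto `qK` acts at label `2` by a scalar `u ∈ U` with `4u = 1`. [claim: Joshi2023ATS2Local, status: disputed] -/
theorem u_H2_iff : JoshiScalingIndeterminacy (uFull p U).toLatticeSituation (uSetting p U) (uQDatum p U) ↔ CandJoshi23.quarter ∈ U := by
  constructor
  · rintro ⟨Φ, hΦ, hq⟩
    obtain ⟨u, hu, hΦc⟩ := (ScalarShells.actsByScalars_of_mem_closure hΦ).scalar 2 ()
    have hmem : (uShells p U).starAut Φ () (uThetaTuple p U ()) ∈ uQDatum p U () (Set.mem_univ _) := by
      rw [hq () (Set.mem_univ _)]; exact ⟨_, uThetaTuple_mem p U (), rfl⟩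
    have h1 : line (2 : toyIndex.Label) () ((uShells p U).starAut Φ () (uThetaTuple p U ()) ⟨2, two_ne_zero_label⟩) = 1 :=
      hmem ⟨2, two_ne_zero_label⟩
    have h2 : line (2 : toyIndex.Label) () ((uShells p U).starAut Φ () (uThetaTuple p U ()) ⟨2, two_ne_zero_label⟩) =
        (u : ℚ) * 4 := by
      rw [← jsq_two, ← line_uPt p U 2 () ((jsq (2 : toyIndex.Label) : ℤ) : ℚ)]
      exact hΦc _
    rw [h2] at h1
    have hu4 : (u : ℚ) = 4⁻¹ := eq_inv_of_mul_eq_one_left h1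
    have : u = CandJoshi23.quarter := Units.ext hu4
    rw [← this]; exact hu
  · intro hq
    exact ⟨uHead p U CandJoshi23.cJ, uHead_mem_closure (cJ_mem_of hq), fun v hv => (starAut_uHead_cJ p U v hv).symm⟩

/-- **THE RESIDUAL CRITERION: S = `PilotKummerIndRelated` HOLDS in the value chart over `U` ⟺ `¼ ∈ U`** (`U` inside the positive
rationals, so that the pins hold and S ⟺ READING R3). The residual is the membership of ONE scalar — the inverse of Joshi's law
`v_{K_2} = 2²·v_{K_1}` — in the indeterminacy group. [claim: Mochizuki2012, status: disputed] -/
theorem u_residual_iff (hU : U ≤ Units.posSubgroup ℚ) :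
    PilotKummerIndRelated (uFull p U).toLatticeSituation (uSetting p U) (uRho p U) (uQDatum p U) ↔ CandJoshi23.quarter ∈ U := by
  constructor
  · intro hS
    obtain ⟨Φ, hΦ, hEq⟩ :=
      (reading3_iff_pilotKummerIndRelated _ _ _ _ (u_kummerB p U 0) (u_pinnedRegions3 p U hU).1).2 hS 2 ()
    obtain ⟨u, hu, hΦc⟩ := (ScalarShells.actsByScalars_of_mem_closure hΦ).scalar 2 ()
    have hu0 : (0 : ℚ) < u := (Units.mem_posSubgroup _).1 (hU hu)
    rw [uSetting_qRegion, if_neg two_ne_zero_label, uSetting_thetaRegion3, image_uHalf_of_line_eq p U _ hu0 hΦc, jsq_two,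
      uHalf_eq_iff] at hEq
    have hu4 : (u : ℚ) = 4⁻¹ := eq_inv_of_mul_eq_one_left hEq.symm
    have : u = CandJoshi23.quarter := Units.ext hu4
    rw [← this]; exact hu
  · intro hq
    exact pilotKummerIndRelated_of_scalingIndeterminacy _ _ _ _ ((u_H2_iff p U).2 hq)

/-! ## 4. Step (x) log-volume invariance ⟺ `U = ⊥`; H_J21-5 ⟺ `U ≠ ⊥` -/

variable {U} in
/-- In the TRIVIAL scalar group every element of `⟨(Ind1)∪(Ind2)⟩` fixes every half-line. [folklore] -/
theorem image_uHalf_eq_self_of_bot (hb : U = ⊥) {Φ : (uShells p U).PacketAut}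
    (hΦ : Φ ∈ Subgroup.closure ((uShells p U).Ind1Family ∪ (uShells p U).Ind2Family))
    (j : toyIndex.Label) (vQ : toyIndex.VQ) (a : ℚ) : Φ j vQ '' uHalf p U j vQ a = uHalf p U j vQ a := by
  obtain ⟨u, hu, hΦc⟩ := (ScalarShells.actsByScalars_of_mem_closure hΦ).scalar j vQ
  have hu1 : (u : ℚ) = 1 := by rw [hb] at hu; rw [Subgroup.mem_bot.1 hu, Units.val_one]
  rw [image_uHalf_of_line_eq p U _ (by rw [hu1]; exact one_pos) hΦc, hu1, one_mul]

variable {U} in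
/-- A nontrivial subgroup has an element `≠ 1`. [folklore] -/
theorem exists_ne_one_of_ne_bot (hne : U ≠ ⊥) : ∃ u ∈ U, u ≠ 1 := by
  rcases U.bot_or_exists_ne_one with h | h
  · exact absurd h hne
  · exact h

/-- **Step (x) log-volume invariance (`MRData.LogvolInvariant`, w4-d103's `hvol`) HOLDS in the value chart over `U` ⟺ `U = ⊥`**:
a scalar `u ≠ 1` changes `μ(H_1) = −log p` into `−u·log p`. [folklore] -/
theorem u_logvolInvariant_iff [Fact p.Prime] (hU : U ≤ Units.posSubgroup ℚ) : (uData p U).LogvolInvariant ↔ U = ⊥ := by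
  constructor
  · intro h
    by_contra hne
    obtain ⟨u, hu, hne1⟩ := exists_ne_one_of_ne_bot hne
    have hu0 : (0 : ℚ) < u := (Units.mem_posSubgroup _).1 (hU hu)
    have hv := h (uHead p U fun _ => u) (Or.inr (uHead_mem_Ind2Family fun _ => hu)) 0 () (uHalf p U 0 () 1) ⟨1, rfl⟩
    change uVol p U 0 () _ = uVol p U 0 () _ at hv
    rw [image_uHalf_uHead_const p U hu0, mul_one] at hv
    exact hne1 (Units.ext ((eq_of_uVol_uHalf_eq p U hv).trans Units.val_one.symm))
  · intro hb Φ hΦ j vQ A hA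
    obtain ⟨a, rfl⟩ := hA
    change uVol p U j vQ _ = uVol p U j vQ _
    rw [image_uHalf_eq_self_of_bot p hb (Subgroup.subset_closure hΦ)]

/-- **H_J21-5 `JoshiNonIsometricIndeterminacy` in the value chart over `U` ⟺ `U ≠ ⊥`.** [claim: Joshi2021ATS1, status: disputed] -/
theorem u_H5_iff [Fact p.Prime] (hU : U ≤ Units.posSubgroup ℚ) (n : ℤ) :
    JoshiNonIsometricIndeterminacy (uSituation p U) n ↔ U ≠ ⊥ := by
  constructor
  · rintro ⟨Φ, hΦ, j, vQ, A, ⟨a, rfl⟩, hne⟩ hb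
    apply hne
    change uVol p U j vQ _ = uVol p U j vQ _
    rw [image_uHalf_eq_self_of_bot p hb hΦ]
  · intro hne
    obtain ⟨u, hu, hne1⟩ := exists_ne_one_of_ne_bot hne
    have hu0 : (0 : ℚ) < u := (Units.mem_posSubgroup _).1 (hU hu)
    refine ⟨uHead p U fun _ => u, uHead_mem_closure fun _ => hu, 0, (), uHalf p U 0 () 1, ⟨1, rfl⟩, ?_⟩
    change uVol p U 0 () _ ≠ uVol p U 0 () _
    rw [image_uHalf_uHead_const p U hu0, mul_one]
    exact fun hv => hne1 (Units.ext ((eq_of_uVol_uHalf_eq p U hv).trans Units.val_one.symm))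

end Summit.ABC.IUTFork.Repair.CandJoshi24

end
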